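import Literature.AlgebraicGeometry.Frobenioids.PadicFrobenioidQpSplit
import Literature.AlgebraicGeometry.Frobenioids.PadicFrobenioidFieldUnitsReconstruction
import HarnessLib

/-!
# Frobenioids II, Ex. 1.1 (ii): the absolutely primitive datum is FIELDWISE SATURATED over an unramified base;
# in particular `C^⊢(ℚ_p)` is — a kernel NON-VACUITY witness for the hypothesis of Thm. 2.4 (ii)

Mochizuki, *The geometry of Frobenioids II: poly-Frobenioids*, Kyushu J. Math. **62** (2008) 401–460, §1,
Example 1.1 (ii), pp. 8–9: `Φ` is *fieldwise saturated* if "`ord(K^×) ⊆ Φ(K)`" for every `Spec K` — the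
hypothesis of Theorem 2.4 (ii) ("If the `Φᵢ` are fieldwise saturated …", p. 20) under which the tree's proof-only
files `PadicFrobenioidFieldUnitsReconstruction` / `…IntegersGroupification` / `…FieldUnitsColimit` and the
criterion/transport files `PadicFieldwiseSaturated*` work (abc-iut cell, layer L1; typer abc-iut-L1-t4's
`PadicFrd.Datum.IsFieldwiseSaturated`, `PadicFrobenioid.lean`).  The tree's first witness is the REALIFIED datum
`Φ := Φ₀|_D` (`PadicFrd.Datum.isFieldwiseSaturated_zero`, abc-iut-w5-d229, `PadicFieldwiseSaturatedGaloisBase.lean`: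
tautological, `ord(K^×) ⊆ Φ₀(K)^gp`).  This file adds the INTEGRAL, absolutely primitive datum `Φ^⊢ = ℤ_{≥0}·ord(p)`
(`Datum.prim` / `Datum.primQp` — the datum carrying `τ_p`, Thm. 1.2 (v) and Rmk. 1.2.1, i.e. [IUTchI] Ex. 3.3 (i)'s
`𝒞_v^⊢`), which is fieldwise saturated exactly over UNRAMIFIED bases.  PROVED here (proof-only, no definitions; seat
abc-iut-w5-d010, follow-up of its RQ7 audit note on p416271/p416451/p416813):

* `PadicFrd.Datum.prim_isFieldwiseSaturated_of_uniformizer` — the absolutely primitive datum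
  `Φ^⊢ = ℤ_{≥0} · ord(p)` (`Datum.prim`, abc-iut-L1-t4 lineage) over a base ALL of whose fields have `p` as a
  uniformizer (every class of `O_K^⊳/O_K^×` is a power of `[p]`, i.e. `K/ℚ_p` unramified) is fieldwise saturated:
  `ord(K^×) = ℤ · ord(p) = (Φ^⊢)^gp` — via the landed bookkeeping `ordUnitsSubgroup_le_of_phiGp_eq` with the
  generator `c₀ = ord(p) ⊗ 1` of `Φ^⊢(A)`;
* `PadicFrd.ordInt_padic_eq_pow_p` — in `ℚ_p` every class of `O^⊳` is `[p]^{v_p}` (abc-iut-L1-t4's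
  `ordIntToNat` is injective and `v_p(p) = 1`);
* **`PadicFrd.primQp_isFieldwiseSaturated : (Datum.primQp p).IsFieldwiseSaturated`** — `C^⊢(ℚ_p)` is fieldwise
  saturated, so the hypothesis of Thm. 2.4 (ii) is INHABITED in the kernel.

(For a ramified `K` the primitive datum is NOT fieldwise saturated — `ord(π) = ord(p)/e ∉ ℤ · ord(p)` — which is why
print distinguishes the two notions.)  Classical bookkeeping; nothing here bears on [IUTchIII] Cor. 3.12; no side taken.
[cite: MochizukiFrdII2008, Ex 1.1 (ii) pp.8-9]
-/

noncomputable section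

namespace Literature.AlgebraicGeometry.Frobenioids

namespace PadicFrd

open CategoryTheory Opposite Function

universe v u

section General

variable {D : Type u} [Category.{v} D] {p : ℕ} [Fact p.Prime] (base : D ⥤ PadicFld.{u} p)

/-- **The absolutely primitive datum `Φ^⊢ = ℤ_{≥0}·ord(p)` is fieldwise saturated over an unramified base**:
if in every base field `K_A` each class of `O^⊳/O^×` is a power of `[p]` (i.e. `p` is a uniformizer), then
`ord(K_A^×) ⊆ (Φ^⊢(A))^gp` for every `A` (Ex. 1.1 (ii) "`ord(K^×) ⊆ Φ(K)`").
[cite: MochizukiFrdII2008, Ex 1.1 (ii) pp.8-9] -/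
theorem Datum.prim_isFieldwiseSaturated_of_uniformizer (hloc : ∀ A : D, (base.obj A).IsPadicLocal)
    (hc : IsConnected D) (he : IsTotallyEpimorphic D)
    (hunr : ∀ (A : D) (a : OrdInt (base.obj A).K),
      ∃ k : ℕ, a = Associates.mk ⟨((p : ℕ) : (base.obj A).K), (base.obj A).p_mem⟩ ^ k) :
    (Datum.prim base hloc hc he).IsFieldwiseSaturated := fun A =>
  (Datum.prim base hloc hc he).ordUnitsSubgroup_le_of_phiGp_eq A (hunr A)
    (c₀ := (⟨primGen base A, Submonoid.mem_powers _⟩ : Submonoid.powers (primGen base A))) rfl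

end General

/-! ### The case `K = ℚ_p` -/

variable (p : ℕ) [Fact p.Prime]

/-- In `ℚ_p`, every class of `O^⊳ = ℤ_p ∖ {0}` modulo units is a power of the class of `p`: `[a] = [p]^{v_p(a)}`
(`ord(O_{ℚ_p}^⊳) ≅ ℤ_{≥0}` generated by `ord(p)`). [cite: MochizukiFrdII2008, Ex 1.1 (i) pp.7-8] -/
theorem ordInt_padic_eq_pow_p (a : OrdInt ℚ_[p]) :
    ∃ k : ℕ, a = Associates.mk ⟨((p : ℕ) : ℚ_[p]), p_mem_intNonzero p⟩ ^ k := by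
  refine ⟨Multiplicative.toAdd (ordIntToNat p a), ordIntToNat_injective p ?_⟩
  rw [map_pow, ordIntToNat_mk]
  have h1 : valNat p ⟨(p : ℚ_[p]), p_mem_intNonzero p⟩ = Multiplicative.ofAdd 1 := by
    change Multiplicative.ofAdd (((p : ℕ) : ℚ_[p]).valuation.toNat) = _
    rw [Padic.valuation_p]
    rfl
  rw [h1, ← ofAdd_nsmul, smul_eq_mul, mul_one, ofAdd_toAdd]

/-- **`C^⊢(ℚ_p)` is fieldwise saturated** (`ord(ℚ_p^×) = ℤ·ord(p) = (Φ^⊢)^gp`): the hypothesis "the `Φᵢ` are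
fieldwise saturated" of [FrdII] Thm. 2.4 (ii) is inhabited by the tree's datum `Datum.primQp p`, which is thus
SIMULTANEOUSLY absolutely primitive (`primQp_isAbsolutelyPrimitive`) and fieldwise saturated. [cite: MochizukiFrdII2008, Ex 1.1 (ii) pp.8-9] -/
theorem primQp_isFieldwiseSaturated : (Datum.primQp p).IsFieldwiseSaturated :=
  Datum.prim_isFieldwiseSaturated_of_uniformizer (qpBase p) _ _ _ fun _ a => ordInt_padic_eq_pow_p p a

/-- Hence, at `C^⊢(ℚ_p)`, the first step of Thm. 2.4 (ii) FIRES with no hypothesis left: the projection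
`B(A) → K_A^× = ℚ_p^×` ("reconstructing the multiplicative group … as the groupification of `O^▷(A)`") is
bijective (abc-iut-w5-d188's `toB0_bijective_of_isFieldwiseSaturated`, fed with `primQp_isFieldwiseSaturated`).
[cite: MochizukiFrdII2008, Thm 2.4 (ii) p.20] -/
theorem primQp_toB0_bijective (A : (Discrete PUnit.{1})ᵒᵖ) :
    Bijective ((Datum.primQp p).toB0.app A).hom :=
  (Datum.primQp p).toB0_bijective_of_isFieldwiseSaturated (primQp_isFieldwiseSaturated p) A

end PadicFrd

end Literature.AlgebraicGeometry.Frobenioids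

end
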